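import Mathlib.Analysis.SpecialFunctions.Pow.Real
import Literature.Probability.RandomPlanarGeometry.HexParafermion
import Literature.Probability.RandomPlanarGeometry.HexSAW
import HarnessLib

/-!
# Objects of the line `tip-martingale-depth-induction` for the crux `SAWDefectDecoherence.DefectDecoherence`
(stmt-CriticalPhenomena-8549; lead prover, crux protocol; skeleton
`Summits/CriticalPhenomena/SAWScalingLimit/Cruxes/DefectDecoherence/Lines/tip-martingale-depth-induction.lean`)

The crux asks for `C` and `θ > 3/4` with `‖T(Λ,a,v)‖ ≤ C R^{-θ} M(Λ,a,v)` for every simply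
connected hexagonal domain `Λ`, adjacent boundary root `a = s(u,w)` (`u ∉ Λ ∋ w`) and `R`-deep
vertex `v`, where `T` is the conjugated vertex-star combination of the Duminil-Copin–Smirnov
observable at `(x_c, 5/8)` and `M` the star mass at spin `0`.  This file only DEFINES the finite
objects the line's registered stubs speak about (so that the stub files under `Theorems/` and the
line's final file can share one vocabulary) — no statement of the line is asserted here:

* `star`, `defect`, `mass`, `ball`, `Deep`, `Admissible`, `DepthBound`, `CrudeBound` — the crux's
  own objects and the uniform depth bound it asks for;
* `IsPrefix`, `Picture`, `pic`, `picDom`, `rot3`, `rotPic`, `prefixSumC`, `prefixSumR`, `picAmp`,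
  `picMass`, `contraction`, `MixingBound` — first-entrance prefixes into the lattice ball `B(v,r)`,
  their scale-`s` pictures, the `ℤ/3` action about `c_v`, and the one-scale orbit-mixing profile;
* `exitMass`, `ExitBound` — the wall–exit tail of the positive mass;
* `strataSum`, `etaNew`, `RecursionStep` — the telescoped one-step recursion across scales.

Sources: H. Duminil-Copin, S. Smirnov, Ann. of Math. 175 (2012) (arXiv:1007.0575), Def. 1 and §4
(the observable, the curl remark); the line card `Lines/tip-martingale-depth-induction.md`.
Deliberately NOT here: the four stub statements (orbit mixing, wall exit, telescoping recursion,
scale induction) and any theorem — they live in the stub files and in the line's final file.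
-/

noncomputable section

open scoped BigOperators ComplexConjugate Classical
open Literature.Probability.LatticeModels Literature.Probability.RandomPlanarGeometry.SAW

namespace Summit.CriticalPhenomena.SAWScalingLimit.Theorems.DefectDecoherence.TipMartingale

/-! ### The objects of the crux -/

/-- `x_c = 1/√(2+√2)`, the critical fugacity of the hexagonal lattice. [cite: DuminilCopinSmirnov2012, Thm 1] -/
abbrev xc : ℝ := hexCriticalFugacity

/-- The star of `v` inside `Λ` (its three neighbours as soon as `v` is `1`-deep). [folklore] -/
def star (Λ : Finset HexVertex) (v : HexVertex) : Finset HexVertex :=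
  Λ.filter (fun t => hexGraph.Adj v t)

/-- The vertex-star DEFECT `T(Λ, a = s(u,w), v) = Σ_{t ∼ v} conj(mid{v,t} - c_v) · F_{x_c,5/8}({v,t})`
(literally the left-hand side of the crux). [folklore] -/
def defect (Λ : Finset HexVertex) (u w v : HexVertex) : ℂ :=
  ∑ t ∈ star Λ v, (starRingEnd ℂ) (hexMidpoint s(v, t) - hexCenter v) *
    hexParafermionicObservable Λ s(u, w) xc (5 / 8) s(v, t)

/-- The star MASS `M(Λ, a, v) = Σ_{t ∼ v} ‖F_{x_c,0}({v,t})‖ = Σ_t Σ_{γ : a → {v,t}} x_c^{ℓ(γ)}`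
(literally the right-hand sum of the crux). [folklore] -/
def mass (Λ : Finset HexVertex) (u w v : HexVertex) : ℝ :=
  ∑ t ∈ star Λ v, ‖hexParafermionicObservable Λ s(u, w) xc 0 s(v, t)‖

/-- The lattice ball of radius `s` about `c_v`, cut out of `Λ` (equal to the full lattice ball when
`v` is `s`-deep). [folklore] -/
def ball (Λ : Finset HexVertex) (v : HexVertex) (s : ℝ) : Finset HexVertex :=
  Λ.filter (fun q => dist (hexCenter q) (hexCenter v) ≤ s)

/-- `v` is `R`-deep in `Λ` (the crux's ball hypothesis). [folklore] -/
def Deep (Λ : Finset HexVertex) (v : HexVertex) (R : ℝ) : Prop :=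
  ∀ y : HexVertex, dist (hexCenter y) (hexCenter v) ≤ R → y ∈ Λ

/-- Admissible configuration at depth `R`: exactly the hypotheses of the crux (simply connected `Λ`,
adjacent boundary root `s(u,w)` with `u ∉ Λ ∋ w`, `1 ≤ R`, `v` `R`-deep).  This class is closed
under slitting by a first-entrance prefix — the lever of the line. [folklore] -/
def Admissible (Λ : Finset HexVertex) (u w v : HexVertex) (R : ℝ) : Prop :=
  hexDomainSimplyConnected Λ ∧ hexGraph.Adj u w ∧ u ∉ Λ ∧ w ∈ Λ ∧ 1 ≤ R ∧ Deep Λ v R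

/-- `DepthBound R b`: at depth `R` the defect/mass ratio is at most `b`, uniformly over admissible
configurations.  The crux is `∃ C, θ > 3/4, ∀ R ≥ 1, DepthBound R (C R^{-θ})`. [folklore] -/
def DepthBound (R b : ℝ) : Prop :=
  ∀ (Λ : Finset HexVertex) (u w v : HexVertex), Admissible Λ u w v R →
    ‖defect Λ u w v‖ ≤ b * mass Λ u w v

/-- The crude (triangle-inequality) bound `‖T‖ ≤ B₀ M` for EVERY configuration (no admissibility);
it holds with `B₀ = 1/2`. [folklore] -/
def CrudeBound (B₀ : ℝ) : Prop :=
  ∀ (Λ : Finset HexVertex) (u w v : HexVertex), ‖defect Λ u w v‖ ≤ B₀ * mass Λ u w v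

/-! ### First-entrance prefixes, pictures, the `ℤ/3` action -/

/-- `γ : a → s(y,z)` is a FIRST-ENTRANCE PREFIX into `B(v,r)`: its vertex list ends at `y`, all its
vertices lie at distance `> r` from `c_v`, and the entrance dart `y → z` lands in `B(v,r)`.  The
continuation then lives in the slit domain `Λ ∖ γ.verts` with root `s(y,z)` (`y` removed, `z`
kept). [folklore] -/
def IsPrefix (v : HexVertex) (r : ℝ) (y z : HexVertex) {Λ : Finset HexVertex} {a : Sym2 HexVertex}
    (γ : HexMidEdgeSAW Λ a s(y, z)) : Prop :=
  γ.verts.getLast? = some y ∧ hexGraph.Adj y z ∧ dist (hexCenter z) (hexCenter v) ≤ r ∧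
    ∀ q ∈ γ.verts, r < dist (hexCenter q) (hexCenter v)

/-- A PICTURE at scale `s`: a vertex set inside `B(v,s)` together with an entrance dart. [folklore] -/
abbrev Picture : Type := Finset HexVertex × HexVertex × HexVertex

/-- The scale-`s` picture of a prefix: its vertices within distance `s` of `c_v`, and its dart. [folklore] -/
def pic (v : HexVertex) (s : ℝ) (y z : HexVertex) {Λ : Finset HexVertex} {a : Sym2 HexVertex}
    (γ : HexMidEdgeSAW Λ a s(y, z)) : Picture :=
  (γ.verts.toFinset.filter (fun q => dist (hexCenter q) (hexCenter v) ≤ s), y, z)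

/-- The PICTURE DOMAIN `B(v,s) ∖ P`: the continuation walks of a prefix with scale-`s` picture `P`
that stay inside `B(v,s)` are exactly the walks of this domain from the root `s(P.2.1, P.2.2)`. [folklore] -/
def picDom (Λ : Finset HexVertex) (v : HexVertex) (s : ℝ) (P : Picture) : Finset HexVertex :=
  ball Λ v s \ P.1

/-- Rotation by `+120°` about the centre of `v`: the lattice vertex whose centre is
`c_v + ζ² (c_y - c_v)` (`ζ = e^{iπ/3}`), a symmetry of the honeycomb.  Explicitly, for
`v = (x, k)` and `y = (p, k')`: `rot3 v y = (x + R²(p - x) + (k - k') e₀, k')` with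
`R = triRot60` (so `R²(m, n) = (-(m+n), m)`); indeed `hexCenter (rot3 v y) - hexCenter v =
ζ² (hexCenter y - hexCenter v)` because `ζ²(1 + ζ) = ζ - 2`. [folklore] -/
def rot3 (v y : HexVertex) : HexVertex :=
  (v.1 + triRot60 (triRot60 (y.1 - v.1)) + (((v.2 : ℕ) : ℤ) - ((y.2 : ℕ) : ℤ)) • Pi.single 0 1,
    y.2)

/-- The `ℤ/3` action on pictures. [folklore] -/
def rotPic (v : HexVertex) (P : Picture) : Picture :=
  (P.1.image (rot3 v), rot3 v P.2.1, rot3 v P.2.2)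

/-- Sum of a complex functional over the first-entrance prefixes of `(Λ, s(u,w))` into `B(v,r)`
(darts range over `Λ × Λ`; non-prefixes contribute `0`). [folklore] -/
def prefixSumC (Λ : Finset HexVertex) (u w v : HexVertex) (r : ℝ)
    (f : ∀ y z : HexVertex, HexMidEdgeSAW Λ s(u, w) s(y, z) → ℂ) : ℂ :=
  ∑ p ∈ Λ ×ˢ Λ, ∑ γ : HexMidEdgeSAW Λ s(u, w) s(p.1, p.2),
    if IsPrefix v r p.1 p.2 γ then f p.1 p.2 γ else 0

/-- Sum of a real functional over the first-entrance prefixes of `(Λ, s(u,w))` into `B(v,r)`. [folklore] -/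
def prefixSumR (Λ : Finset HexVertex) (u w v : HexVertex) (r : ℝ)
    (f : ∀ y z : HexVertex, HexMidEdgeSAW Λ s(u, w) s(y, z) → ℝ) : ℝ :=
  ∑ p ∈ Λ ×ˢ Λ, ∑ γ : HexMidEdgeSAW Λ s(u, w) s(p.1, p.2),
    if IsPrefix v r p.1 p.2 γ then f p.1 p.2 γ else 0

/-- Prefix AMPLITUDE of a picture: `A_s(P) = Σ_{π : pic_s(π) = P} e^{-iσW(π)} x_c^{|π|}` (`σ = 5/8`). [folklore] -/
def picAmp (Λ : Finset HexVertex) (u w v : HexVertex) (r s : ℝ) (P : Picture) : ℂ :=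
  prefixSumC Λ u w v r fun y z γ => if pic v s y z γ = P then γ.weight xc (5 / 8) else 0

/-- Prefix MASS of a picture: `m_s(P) = Σ_{π : pic_s(π) = P} x_c^{|π|}`. [folklore] -/
def picMass (Λ : Finset HexVertex) (u w v : HexVertex) (r s : ℝ) (P : Picture) : ℝ :=
  prefixSumR Λ u w v r fun y z γ => if pic v s y z γ = P then xc ^ γ.length else 0

/-- The ORBIT CONTRACTION of a picture:
`c_s(P) = ‖Σ_{k<3} ω̄^k A_s(ρ^k P)‖ / Σ_{k<3} m_s(ρ^k P)` (`ω = ζ²`, `ρ = rot3 v`); orbit-invariant,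
`≤ 1`, and equal to the modulus of the `13/8`-characteristic function of the lifted entrance angle
given the exact picture (junk value `0` when the orbit carries no prefix). [folklore] -/
def contraction (Λ : Finset HexVertex) (u w v : HexVertex) (r s : ℝ) (P : Picture) : ℝ :=
  ‖∑ k ∈ Finset.range 3, (starRingEnd ℂ) (triZeta ^ 2) ^ k *
      picAmp Λ u w v r s ((rotPic v)^[k] P)‖ /
    ∑ k ∈ Finset.range 3, picMass Λ u w v r s ((rotPic v)^[k] P)

/-- ONE-SCALE ORBIT MIXING with profile `φ`: for every admissible configuration at depth `R`, every
entrance radius `r ≥ 1` and picture scale `s ∈ [r+1, R]`, the orbit contraction, averaged over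
first-entrance prefixes with the positive weights `x_c^{|π|} · M(picture domain of π)`, is at most
`φ(R/s)`.  A statement about the POSITIVE walk law only (no defect values). [folklore] -/
def MixingBound (φ : ℝ → ℝ) : Prop :=
  ∀ (Λ : Finset HexVertex) (u w v : HexVertex) (R : ℝ), Admissible Λ u w v R →
    ∀ r s : ℝ, 1 ≤ r → r + 1 ≤ s → s ≤ R →
      prefixSumR Λ u w v r (fun y z γ =>
          contraction Λ u w v r s (pic v s y z γ) *
            (xc ^ γ.length * mass (picDom Λ v s (pic v s y z γ)) y z v))
        ≤ φ (R / s) * prefixSumR Λ u w v r (fun y z γ =>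
            xc ^ γ.length * mass (picDom Λ v s (pic v s y z γ)) y z v)

/-- EXIT MASS beyond radius `L`: the mass of the walks `a → star(v)` visiting a vertex at distance
`> L` from `c_v`. [folklore] -/
def exitMass (Λ : Finset HexVertex) (u w v : HexVertex) (L : ℝ) : ℝ :=
  ∑ t ∈ star Λ v, ∑ γ : HexMidEdgeSAW Λ s(u, w) s(v, t),
    if (∃ q ∈ γ.verts, L < dist (hexCenter q) (hexCenter v)) then xc ^ γ.length else 0

/-- WALL–EXIT BOUND with constant `c` and exponent `β`: for every admissible configuration at
depth `ρ` whose root enters within distance `ρ` of `v`, the fraction of the star mass carried by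
walks reaching distance `> L` is at most `c (L/ρ)^{-β}`. [folklore] -/
def ExitBound (c β : ℝ) : Prop :=
  ∀ (Λ : Finset HexVertex) (u w v : HexVertex) (ρ L : ℝ), Admissible Λ u w v ρ →
    dist (hexCenter w) (hexCenter v) ≤ ρ → ρ ≤ L →
      exitMass Λ u w v L ≤ c * (L / ρ) ^ (-β) * mass Λ u w v

/-! ### The recursion across scales -/

/-- Strata cost of the walks leaving radius `C·r` from an admissible configuration at depth `r`:
stratum `j < N` (closest pre-exit approach in `(r/2^{j+1}, r/2^j]`) has mass `≤ c (C 2^j)^{-β} M`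
and defect ratio `≤ η(r/2^{j+1})`; the last stratum (approach `≤ r/2^N < 2`) is paid crudely. [folklore] -/
def strataSum (c β B₀ r : ℝ) (N : ℕ) (η : ℝ → ℝ) (C : ℝ) : ℝ :=
  c * ((∑ j ∈ Finset.range N, (C * 2 ^ j) ^ (-β) * η (r / 2 ^ (j + 1))) +
    (C * 2 ^ N) ^ (-β) * B₀)

/-- The new ratio bound at depth `R` produced by one telescoped step with entrance radius `r`,
picture scales `s₀ 2^i` (`i ≤ J`). [folklore] -/
def etaNew (φ : ℝ → ℝ) (c β B₀ : ℝ) (η : ℝ → ℝ) (R r s₀ : ℝ) (J N : ℕ) : ℝ :=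
  φ (R / s₀) * η r +
    (∑ i ∈ Finset.range J,
      φ (R / (s₀ * 2 ^ (i + 1))) * strataSum c β B₀ r N η (s₀ * 2 ^ i / r)) +
    strataSum c β B₀ r N η (s₀ * 2 ^ J / r)

/-- ONE STEP OF THE DEPTH RECURSION for an abstract depth-bound predicate `D`: any nonnegative
profile `η` valid at all depths `≥ 1` yields, at depth `R`, the bound `etaNew …` for every choice
of entrance radius `r` (with `r/2^N ∈ [1,2)`), first picture scale `s₀ ≥ r + 1` and number of
doublings `J` with `s₀ 2^J ≤ R`. [folklore] -/
def RecursionStep (D : ℝ → ℝ → Prop) (φ : ℝ → ℝ) (c β B₀ : ℝ) : Prop :=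
  ∀ η : ℝ → ℝ, (∀ ρ, 0 ≤ η ρ) → (∀ ρ, 1 ≤ ρ → D ρ (η ρ)) →
    ∀ (R r s₀ : ℝ) (J N : ℕ), 1 ≤ r / 2 ^ N → r / 2 ^ N < 2 → r + 1 ≤ s₀ → s₀ * 2 ^ J ≤ R →
      D R (etaNew φ c β B₀ η R r s₀ J N)

/-! ### Trivial API (registered sub-goals, so that this vocabulary file supports the crux item) -/

/-- The star mass is nonnegative. [folklore] -/
theorem mass_nonneg : ∀ (Λ : Finset HexVertex) (u w v : HexVertex), 0 ≤ mass Λ u w v :=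
  fun _ _ _ _ => Finset.sum_nonneg fun _ _ => norm_nonneg _

/-- `DepthBound` is monotone in the bound (masses are nonnegative). [folklore] -/
theorem depthBound_mono : ∀ (R b b' : ℝ), b ≤ b' → DepthBound R b → DepthBound R b' := by
  intro R b b' h hb Λ u w v hadm
  exact (hb Λ u w v hadm).trans (mul_le_mul_of_nonneg_right h (mass_nonneg Λ u w v))

end Summit.CriticalPhenomena.SAWScalingLimit.Theorems.DefectDecoherence.TipMartingale

end
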